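import Literature.NumberTheory.LFunctions.Zhang2022.Section5ExceptionalZero
import Literature.NumberTheory.LFunctions.Zhang2022.SkeletonSetting
import Literature.NumberTheory.LFunctions.ExplicitDeuringHeilbronnDirichlet
import Literature.NumberTheory.LFunctions.ExplicitExceptionalZeroBoundsRealCharacters
import Literature.NumberTheory.LFunctions.ExplicitLogFreeZeroDensityDirichlet
import Literature.NumberTheory.LFunctions.DirichletLZeroCountExplicit
import Literature.NumberTheory.LFunctions.DirichletLFunctionZeroReflection
import Literature.NumberTheory.LFunctions.PairCorrelationSubnormalGaps
import HarnessLib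

/-!
# The (A)-side premise and the explicit existence input of the explicit Deuring–Heilbronn chains
# (cell `landau-siegel`, family B-dh, rows dhE-12 and dhE-13 of `B-dh/EDLIST.md`)

Topic `Literature/NumberTheory/LFunctions/Zhang2022` (namespace
`Literature.NumberTheory.LFunctions.Zhang2022.DH`). Everything in this file is PROVED (theorems
only; no definition, no named fact): the two inputs that EVERY explicit repulsion / log-free
zero-density chain of the family B-dh («explicit Deuring–Heilbronn hybrids as a substitute
endgame», `pub/landau-siegel/B-dh/PLAN.md` v1 §2–§4) feeds into the printed explicit theorems of
Benli–Goel–Twiss–Zaman (`BGTZ2025.corollary11`, `.theorem13`) and Thorner–Zaman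
(`thornerZaman2024_theorem12`, `_theorem215`), stated in EXACTLY the window those theorems quantify
over:

* **dhE-12 (`exceptionalZero_of_assumptionA`).** Under Zhang's Assumption (A)
  `‖L(1,χ)‖ < (log D)⁻²⁰²²` (`Skeleton.AssumptionA D χ`, [cite: Zhang2022LandauSiegel, §2 Assumption (A)])
  and for all large `D`: `L(s,χ)` has a real zero `β₁` in the Benli–Goel–Twiss–Zaman window
  `(1 − 1/(10 log D), 1)`, simple, with `χ² = χ₀`; it is the ONLY real zero of ANY `L(s,ψ)`,
  `ψ` mod `D`, in that window (McCurley's explicit at-most-one-zero theorem, tree named fact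
  `McCurley1984_theorem1`); and `0.72 (1 − β₁) ≤ ‖L(1,χ)‖` (Benli–Goel–Twiss–Zaman Lemma 2.9, tree
  named fact `BGTZ2025.lemma29`), whence `1 − β₁ < (25/18)(log D)⁻²⁰²²`. The existence, simplicity
  and `1 − β₁ ≤ K‖L(1,χ)‖` (inexplicit `K`) are the tree's PROVED
  `Zhang2022.lemma55_exceptionalZero` (Hecke–Landau read contrapositively with Montgomery–Vaughan
  Theorems 11.3–11.4); for `log D > 10K` the bound `K(log D)⁻²⁰²²` puts `β₁` inside the explicit
  window, and the two print facts enter as hypotheses `(h29 : BGTZ2025.lemma29)`,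
  `(hM : McCurley1984_theorem1)` — nothing new is assumed.
* **dhE-13 (`exists_zero_half_le_re_of_bmor`).** From Bennett–Martin–O'Bryant–Rechnitzer's explicit
  zero count (tree named fact `bmor2021_theorem11`, and its PROVED consequence
  `exists_lfunctionZero_abs_im_le_one_of_bmor`: a primitive `L(s,χ)` of conductor `q ≥ 10⁵⁰` has a
  zero `ρ` with `0 < Re ρ < 1`, `|Im ρ| ≤ 1`) and the reflection `ρ ↦ 1 − ρ̄` of the zeros of a
  primitive `L(s,χ)` (tree `LFunction_one_sub_conj_eq_zero`, Montgomery–Vaughan §10.1): such an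
  `L(s,χ)` has a zero with `1/2 ≤ Re ρ < 1`, `|Im ρ| ≤ 1` — the strongest UNCONDITIONAL existence
  statement available to a chain whose repulsion input (`BGTZ2025.Repulsion`) speaks of zeros with
  `Re ρ > 1/2` (B-dh/PLAN.md §1: the closed half-strip `Re ρ ≥ 1/2` is all that print supplies).

WHAT THIS IS NOT: no claim about Landau–Siegel zeros or about Theorems 1–2 of arXiv:2211.02515;
(A) is a HYPOTHESIS throughout (the manuscript's assumption to be refuted), never asserted. The
thresholds `D₀` are existential (they inherit the inexplicit constant `K` of
`lemma55_exceptionalZero`); the family's exit to the summit side is asymptotic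
(`Skeleton.theorem1_of_eventually_not_assumptionA`), so nothing is lost. No instance, no notation.

«The programme SEARCHES and TYPES; no claim about Landau–Siegel zeros, Theorems 1–2 of
arXiv:2211.02515 or a repaired Margin232 until a kernel theorem says so.»

## References

* [Zhang2022LandauSiegel] Y. Zhang, arXiv:2211.02515v1, §2 Assumption (A), §5 Lemma 5.5.
* [BenliGoelTwissZaman2025] K. Benli, S. Goel, H. Twiss, A. Zaman, PAMS 2025, arXiv:2410.06082,
  Corollary 1.1 (the window `β₁ > 1 − 1/(10 log q)`), Lemma 2.9 (`0.72 ≤ L(1,χ₁)/(1 − β₁)`).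
* [McCurley1984ZFR] K. S. McCurley, J. Number Theory 19 (1984), Theorem 1.
* [BennettMartinOBryantRechnitzer2021] M. A. Bennett, G. Martin, K. O'Bryant, A. Rechnitzer,
  *Counting zeros of Dirichlet L-functions*, Math. Comp. 90 (2021), Theorem 1.1 and p. 3.
* [MontgomeryVaughan2007] H. L. Montgomery, R. C. Vaughan, *Multiplicative Number Theory I*,
  §10.1 (after Cor. 10.8), Theorems 11.3–11.4.
-/

noncomputable section

open Complex
open scoped ComplexConjugate

namespace Literature.NumberTheory.LFunctions.Zhang2022.DH

/-! ### dhE-13: an unconditional zero with `Re ρ ≥ 1/2`, `|Im ρ| ≤ 1` -/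

/-- **Existence input of the repulsion chains (row dhE-13):** given Bennett–Martin–O'Bryant–
Rechnitzer's Theorem 1.1, every primitive `L(s,χ)` of conductor `q ≥ 10⁵⁰` has a zero `ρ` with
`1/2 ≤ Re ρ < 1` and `|Im ρ| ≤ 1` (a zero with `0 < Re ρ < 1`, `|Im ρ| ≤ 1` exists by the explicit
count; if `Re ρ < 1/2`, its reflection `1 − ρ̄` is again a zero, with `Re > 1/2` and the same
`|Im|`). [cite: BennettMartinOBryantRechnitzer2021, Theorem 1.1 and p. 3]
[cite: MontgomeryVaughan2007, §10.1 (after Cor. 10.8)] -/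
theorem exists_zero_half_le_re_of_bmor (h : bmor2021_theorem11) {q : ℕ} [NeZero q]
    (hq : 10 ^ 50 ≤ q) (χ : DirichletCharacter ℂ q) (hχ : χ.IsPrimitive) :
    ∃ ρ : ℂ, χ.LFunction ρ = 0 ∧ 1 / 2 ≤ ρ.re ∧ ρ.re < 1 ∧ |ρ.im| ≤ 1 := by
  obtain ⟨ρ, h0, hre0, hre1, him⟩ := exists_lfunctionZero_abs_im_le_one_of_bmor h hq χ hχ
  rcases le_or_gt (1 / 2 : ℝ) ρ.re with hge | hlt
  · exact ⟨ρ, h0, hge, hre1, him⟩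
  · have hq1 : q ≠ 1 := by
      intro h1
      rw [h1] at hq
      norm_num at hq
    refine ⟨1 - conj ρ, LFunction_one_sub_conj_eq_zero hχ hq1 h0 hre0, ?_, ?_, ?_⟩
    · simp only [sub_re, one_re, conj_re]; linarith
    · simp only [sub_re, one_re, conj_re]; linarith
    · simp only [sub_im, one_im, conj_im, zero_sub, abs_neg]; exact him

/-! ### dhE-12: Assumption (A) places the exceptional zero in the explicit window -/

/-- For every real `M` there is `D₀` with `M ≤ log D` for all `D ≥ D₀`. [folklore] -/
private theorem exists_nat_le_log (M : ℝ) : ∃ D₀ : ℕ, ∀ D : ℕ, D₀ ≤ D → M ≤ Real.log D := by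
  refine ⟨⌈Real.exp M⌉₊ + 1, fun D hD => ?_⟩
  have h1 : Real.exp M ≤ D := by
    have : (⌈Real.exp M⌉₊ : ℝ) + 1 ≤ D := by exact_mod_cast hD
    linarith [Nat.le_ceil (Real.exp M)]
  have hD0 : (0 : ℝ) < D := lt_of_lt_of_le (Real.exp_pos M) h1
  rw [Real.le_log_iff_exp_le hD0]
  exact h1

/-- At a real point `β` and a modulus `D ≥ 10`, McCurley's threshold
`1 − 1/(9.645908801 · log max(D, D|Im β|, 10)) = 1 − 1/(9.645908801 log D)` lies below the
Benli–Goel–Twiss–Zaman threshold `1 − 1/(10 log D)`. [cite: McCurley1984ZFR, Theorem 1]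
[cite: BenliGoelTwissZaman2025, Corollary 1.1] -/
private theorem mcCurley_threshold_le {D : ℕ} (hD10 : (10 : ℝ) ≤ D) (β : ℝ) :
    1 - 1 / (9.645908801 * Real.log (max (max (D : ℝ) ((D : ℝ) * |((β : ℝ) : ℂ).im|)) 10)) ≤
      1 - 1 / (10 * Real.log D) := by
  have hmax : max (max (D : ℝ) ((D : ℝ) * |((β : ℝ) : ℂ).im|)) 10 = D := by
    rw [Complex.ofReal_im, abs_zero, mul_zero, max_eq_left (by linarith : (0 : ℝ) ≤ D),
      max_eq_left hD10]
  rw [hmax]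
  have hlog : 0 < Real.log D := Real.log_pos (by linarith)
  have h1 : 9.645908801 * Real.log D ≤ 10 * Real.log D := by nlinarith
  have h2 : 1 / (10 * Real.log D) ≤ 1 / (9.645908801 * Real.log D) :=
    one_div_le_one_div_of_le (by positivity) h1
  linarith

/-- **Row dhE-12 from the LOWER half of Lemma 2.9 only.** The proof of
`exceptionalZero_of_assumptionA` below uses Benli–Goel–Twiss–Zaman's Lemma 2.9 only through its first
inequality `0.72 (1 − β₁) ≤ L(1,χ₁)`; this is the same statement with that inequality as the hypothesis
`hlow` (the shape of the first conjunct of `BGTZ2025.lemma29`), so that any discharge of the lower half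
feeds the row — e.g. `BGTZ2025.lemma29_lower_of_platt` of `ExplicitExceptionalZeroBoundsRealCharacters`
(the kernel constant `0.81`, modulo `platt2016_theorem71`), giving dhE-12 modulo Platt 2016 Thm 7.1 and
McCurley 1984 Thm 1. [cite: Zhang2022LandauSiegel, §2 Assumption (A) and §5 Lemma 5.5]
[cite: BenliGoelTwissZaman2025, Lemma 2.9 and Corollary 1.1] [cite: McCurley1984ZFR, Theorem 1] -/
theorem exceptionalZero_of_assumptionA_of_lower
    (hlow : ∀ (q : ℕ) [NeZero q], 400000 < q → ∀ χ₁ : DirichletCharacter ℂ q, χ₁.IsQuadratic → χ₁ ≠ 1 →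
      ∀ β₁ : ℝ, 1 - 1 / (10 * Real.log q) < β₁ → β₁ < 1 → χ₁.LFunction β₁ = 0 →
        0.72 * (1 - β₁) ≤ (χ₁.LFunction 1).re)
    (hM : McCurley1984_theorem1) :
    ∃ D₀ : ℕ, ∀ (D : ℕ) [NeZero D], D₀ ≤ D → ∀ χ : DirichletCharacter ℂ D, χ ≠ 1 →
      Skeleton.AssumptionA D χ →
      ∃ β₁ : ℝ, 1 - 1 / (10 * Real.log D) < β₁ ∧ β₁ < 1 ∧ χ.LFunction β₁ = 0 ∧
        deriv χ.LFunction β₁ ≠ 0 ∧ χ ^ 2 = 1 ∧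
        (∀ (ψ : DirichletCharacter ℂ D) (β : ℝ), 1 - 1 / (10 * Real.log D) < β → β < 1 →
            ψ.LFunction β = 0 → ψ = χ ∧ β = β₁) ∧
        0.72 * (1 - β₁) ≤ ‖χ.LFunction 1‖ ∧
        1 - β₁ < 25 / 18 / Real.log D ^ 2022 := by
  obtain ⟨D₁, K, hK, c, -, H⟩ := lemma55_exceptionalZero
  obtain ⟨D₂, hD₂⟩ := exists_nat_le_log (10 * K + 1)
  refine ⟨max D₁ (max D₂ 400001), fun D _ hD χ hχ hA => ?_⟩
  have hD₁ : D₁ ≤ D := le_trans (le_max_left _ _) hD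
  have hD₂' : D₂ ≤ D := le_trans (le_max_left _ _) (le_trans (le_max_right _ _) hD)
  have hD4 : 400001 ≤ D := le_trans (le_max_right _ _) (le_trans (le_max_right _ _) hD)
  have hlogK : 10 * K + 1 ≤ Real.log D := hD₂ D hD₂'
  have hlog1 : 1 ≤ Real.log D := by nlinarith
  have hlog0 : 0 < Real.log D := by linarith
  have hD10 : (10 : ℝ) ≤ D := by
    have : (400001 : ℝ) ≤ D := by exact_mod_cast hD4
    linarith
  -- Assumption (A) in the form consumed by `lemma55_exceptionalZero`
  have hA' : ‖χ.LFunction 1‖ < (Real.log D ^ 2022)⁻¹ := by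
    have h := hA
    unfold Skeleton.AssumptionA at h
    rwa [one_div] at h
  obtain ⟨ρ, hρ1, hρ0, hder, hsq, hKρ, -, -, -⟩ := H D hD₁ χ hχ hA'
  -- the window: `K (log D)⁻²⁰²² < 1/(10 log D)` because `log D ^ 2021 ≥ log D > 10 K`
  have hwin : K * (Real.log D ^ 2022)⁻¹ < 1 / (10 * Real.log D) := by
    rw [← one_div, mul_one_div, div_lt_div_iff₀ (by positivity) (by positivity), one_mul]
    have hpow : Real.log D ≤ Real.log D ^ 2021 := le_self_pow₀ hlog1 (by norm_num)
    calc K * (10 * Real.log D) = 10 * K * Real.log D := by ring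
      _ < Real.log D * Real.log D := by
          have : 10 * K < Real.log D := by linarith
          exact mul_lt_mul_of_pos_right this hlog0
      _ ≤ Real.log D ^ 2021 * Real.log D := mul_le_mul_of_nonneg_right hpow hlog0.le
      _ = Real.log D ^ 2022 := by ring
  have hlo : 1 - 1 / (10 * Real.log D) < ρ := by linarith
  -- Benli–Goel–Twiss–Zaman Lemma 2.9
  have hquad : χ.IsQuadratic := MulChar.isQuadratic_iff_sq_eq_one.mpr hsq
  have hq4 : 400000 < D := lt_of_lt_of_le (by norm_num) hD4
  have h72 := hlow D hq4 χ hquad hχ ρ hlo hρ1 hρ0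
  have h72' : 0.72 * (1 - ρ) ≤ ‖χ.LFunction 1‖ := h72.trans (Complex.re_le_norm _)
  refine ⟨ρ, hlo, hρ1, hρ0, hder, hsq, ?_, h72', ?_⟩
  · -- uniqueness in the window among all characters mod `D`: McCurley's Theorem 1 at real points
    intro ψ β hβlo hβ1 hβ0
    have hD3 : 3 ≤ D := le_trans (by norm_num) hD4
    have hβne : ((β : ℝ) : ℂ) ≠ 1 := by
      intro h
      have : β = 1 := by exact_mod_cast h
      linarith
    have hρne : ((ρ : ℝ) : ℂ) ≠ 1 := by
      intro h
      have : ρ = 1 := by exact_mod_cast h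
      linarith
    have hβreg : 1 - 1 / (9.645908801 *
        Real.log (max (max (D : ℝ) ((D : ℝ) * |((β : ℝ) : ℂ).im|)) 10)) < ((β : ℝ) : ℂ).re := by
      rw [Complex.ofReal_re]
      exact lt_of_le_of_lt (mcCurley_threshold_le hD10 β) hβlo
    have hρreg : 1 - 1 / (9.645908801 *
        Real.log (max (max (D : ℝ) ((D : ℝ) * |((ρ : ℝ) : ℂ).im|)) 10)) < ((ρ : ℝ) : ℂ).re := by
      rw [Complex.ofReal_re]
      exact lt_of_le_of_lt (mcCurley_threshold_le hD10 ρ) hlo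
    obtain ⟨⟨hψχ, hβρ⟩, -, -, -⟩ := hM D hD3 ψ χ (β : ℂ) (ρ : ℂ) hβne hρne hβreg hρreg hβ0 hρ0
    exact ⟨hψχ, by exact_mod_cast hβρ⟩
  · -- `1 − β₁ < (25/18)(log D)⁻²⁰²²` from `0.72 (1 − β₁) ≤ ‖L(1,χ)‖ < (log D)⁻²⁰²²`
    have hlt : 0.72 * (1 - ρ) < 1 / Real.log D ^ 2022 := lt_of_le_of_lt h72' hA
    have hpos : 0 < Real.log D ^ 2022 := by positivity
    rw [lt_div_iff₀ hpos] at hlt ⊢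
    linarith


/-- **The (A)-side premise of every B-dh chain (row dhE-12), PROVED modulo the two print facts it
quotes.** Given Benli–Goel–Twiss–Zaman's Lemma 2.9 (`BGTZ2025.lemma29`) and McCurley's Theorem 1
(`McCurley1984_theorem1`): there is `D₀` such that for every modulus `D ≥ D₀` and every Dirichlet
character `χ ≠ χ₀` mod `D` satisfying Zhang's Assumption (A) `‖L(1,χ)‖ < (log D)⁻²⁰²²`, there is a
real `β₁` with
* `1 − 1/(10 log D) < β₁ < 1` and `L(β₁,χ) = 0` (the window of `BGTZ2025.corollary11` /
  `.theorem13`), `L'(β₁,χ) ≠ 0`, `χ² = χ₀`;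
* UNIQUENESS: every real zero `β ∈ (1 − 1/(10 log D), 1)` of any `L(s,ψ)`, `ψ` mod `D`, has
  `ψ = χ` and `β = β₁`;
* `0.72 (1 − β₁) ≤ ‖L(1,χ)‖`, hence `1 − β₁ < (25/18) (log D)⁻²⁰²²` (`25/18 = 1/0.72`).
Proof: `Zhang2022.lemma55_exceptionalZero` (existence, simplicity, `χ² = 1`,
`1 − β₁ ≤ K (log D)⁻²⁰²²`), the choice `log D ≥ 10K + 1` (so `K(log D)⁻²⁰²² < 1/(10 log D)`),
`BGTZ2025.lemma29` for `D > 400 000`, and `McCurley1984_theorem1` at real points for `D ≥ 10`.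
[cite: Zhang2022LandauSiegel, §2 Assumption (A) and §5 Lemma 5.5]
[cite: BenliGoelTwissZaman2025, Lemma 2.9 and Corollary 1.1] [cite: McCurley1984ZFR, Theorem 1] -/
theorem exceptionalZero_of_assumptionA (h29 : BGTZ2025.lemma29) (hM : McCurley1984_theorem1) :
    ∃ D₀ : ℕ, ∀ (D : ℕ) [NeZero D], D₀ ≤ D → ∀ χ : DirichletCharacter ℂ D, χ ≠ 1 →
      Skeleton.AssumptionA D χ →
      ∃ β₁ : ℝ, 1 - 1 / (10 * Real.log D) < β₁ ∧ β₁ < 1 ∧ χ.LFunction β₁ = 0 ∧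
        deriv χ.LFunction β₁ ≠ 0 ∧ χ ^ 2 = 1 ∧
        (∀ (ψ : DirichletCharacter ℂ D) (β : ℝ), 1 - 1 / (10 * Real.log D) < β → β < 1 →
            ψ.LFunction β = 0 → ψ = χ ∧ β = β₁) ∧
        0.72 * (1 - β₁) ≤ ‖χ.LFunction 1‖ ∧
        1 - β₁ < 25 / 18 / Real.log D ^ 2022 := by
  exact exceptionalZero_of_assumptionA_of_lower
    (fun q _ hq χ₁ hquad hne β₁ hlo hβ1 hz => (h29 q hq χ₁ hquad hne β₁ hlo hβ1 hz).1) hM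

/-- **Row dhE-12 modulo the two INSTRUMENT facts `platt2016_theorem71` (Platt's certified GRH
computation to `4·10⁵`) and `McCurley1984_theorem1` (McCurley's printed zero-free region)** — the print
fact `BGTZ2025.lemma29` replaced by the kernel's lower half `BGTZ2025.lemma29_lower_of_platt`
(`0.81 ≥ 0.72`, hyperbola method at the zero; `ExplicitExceptionalZeroBoundsRealCharacters`).
[cite: Zhang2022LandauSiegel, §2 Assumption (A) and §5 Lemma 5.5]
[cite: BenliGoelTwissZaman2025, Lemma 2.9 and Corollary 1.1] [cite: Platt2016GRH, Theorem 7.1]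
[cite: McCurley1984ZFR, Theorem 1] -/
theorem exceptionalZero_of_assumptionA_of_platt (hP : platt2016_theorem71) (hM : McCurley1984_theorem1) :
    ∃ D₀ : ℕ, ∀ (D : ℕ) [NeZero D], D₀ ≤ D → ∀ χ : DirichletCharacter ℂ D, χ ≠ 1 →
      Skeleton.AssumptionA D χ →
      ∃ β₁ : ℝ, 1 - 1 / (10 * Real.log D) < β₁ ∧ β₁ < 1 ∧ χ.LFunction β₁ = 0 ∧
        deriv χ.LFunction β₁ ≠ 0 ∧ χ ^ 2 = 1 ∧
        (∀ (ψ : DirichletCharacter ℂ D) (β : ℝ), 1 - 1 / (10 * Real.log D) < β → β < 1 →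
            ψ.LFunction β = 0 → ψ = χ ∧ β = β₁) ∧
        0.72 * (1 - β₁) ≤ ‖χ.LFunction 1‖ ∧
        1 - β₁ < 25 / 18 / Real.log D ^ 2022 :=
  exceptionalZero_of_assumptionA_of_lower (BGTZ2025.lemma29_lower_of_platt hP) hM

/-! ### The (A)-world quasi-Riemann hypothesis (appended 2026-08-26, B-dh/PLAN.md §3 «second wave»)

What «explicit Deuring–Heilbronn as a substitute» converts Assumption (A) INTO, as a kernel
statement: under (A), Benli–Goel–Twiss–Zaman's Corollary 1.1 applied at every modulus `q ≡ 0 (mod D)`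
with `log q ≤ 0.072 (log D)^{2022}` (the exceptional zero `β₁` of `L(s,χ)` is a zero of
`∏_{ψ mod q} L(s,ψ)` through `χ` lifted to level `q`, Mathlib `LFunction_changeLevel`, and lies in
the window `β₁ > 1 − 1/(10 log q)` exactly in that range of `q`) empties the region
`Re ρ ≥ 1 − (2022 log log D + log(9/200) − log K)/K`, `K = 10 log q + log T + 107`, `|Im ρ| ≤ T`,
`Re ρ > 1/2`, `ρ ≠ β₁`, of zeros of EVERY `L(s,ψ)`, `ψ` mod `q` — a quasi-GRH of width
`w ~ 202 log log D/log q`. B-dh/PLAN.md §1/§3: this collides with nothing in print (all unconditional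
existence statements live in the closed strip `Re ρ ≥ 1/2`); a closing design of the family must
import a zero violating this conclusion (exit kind (iii)). Zeros with `Re ρ ≤ 1/2` — where every
unconditional existence theorem places them — are untouched by the statement (the referee's D1 «no»
for every repulsion design). -/

/-- **The (A)-world explicit quasi-Riemann hypothesis.** Given Benli–Goel–Twiss–Zaman's Lemma 2.9 and
Corollary 1.1 (`BGTZ2025.lemma29`, `BGTZ2025.corollary11`) and McCurley's Theorem 1
(`McCurley1984_theorem1`): there is `D₀` such that for every `D ≥ D₀`, every `χ ≠ χ₀` mod `D` with
Assumption (A), the exceptional zero `β₁ ∈ (1 − 1/(10 log D), 1)` of `exceptionalZero_of_assumptionA`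
(`1 − β₁ < (25/18)(log D)⁻²⁰²²`) REPELS, for every modulus `q` with `D ∣ q` and
`log q ≤ (9/125)(log D)^{2022}` and every `T ≥ 4`, every zero `ρ ≠ β₁`, `ρ ≠ 1` of every `L(s,ψ)`,
`ψ` mod `q`, with `Re ρ > 1/2`, `|Im ρ| ≤ T`:
`Re ρ < repulsionBound 10 1 107 (1/16) q T β₁ < 1 − (2022 log log D + log(9/200) − log K)/K`,
`K = 10 log q + log T + 107`. (The window at level `q` holds because
`(25/18)(log D)⁻²⁰²² ≤ 1/(10 log q)` iff `log q ≤ (9/125)(log D)^{2022}`; `q ≥ D > 400 000`.)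
[cite: BenliGoelTwissZaman2025, Corollary 1.1 and Lemma 2.9] [cite: Zhang2022LandauSiegel, §2 Assumption (A)]
[cite: McCurley1984ZFR, Theorem 1] -/
theorem quasiRH_of_assumptionA (h29 : BGTZ2025.lemma29) (hM : McCurley1984_theorem1)
    (h11 : BGTZ2025.corollary11) :
    ∃ D₀ : ℕ, ∀ (D : ℕ) [NeZero D], D₀ ≤ D → ∀ χ : DirichletCharacter ℂ D, χ ≠ 1 →
      Skeleton.AssumptionA D χ →
      ∃ β₁ : ℝ, 1 - 1 / (10 * Real.log D) < β₁ ∧ β₁ < 1 ∧ χ.LFunction β₁ = 0 ∧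
        1 - β₁ < 25 / 18 / Real.log D ^ 2022 ∧
        ∀ (q : ℕ) [NeZero q], D ∣ q → Real.log q ≤ 9 / 125 * Real.log D ^ 2022 →
          ∀ T : ℝ, 4 ≤ T → ∀ (ψ : DirichletCharacter ℂ q) (ρ : ℂ), ρ ≠ 1 → ρ ≠ ((β₁ : ℝ) : ℂ) →
            ψ.LFunction ρ = 0 → 1 / 2 < ρ.re → |ρ.im| ≤ T →
              ρ.re < BGTZ2025.repulsionBound 10 1 107 (1 / 16) q T β₁ ∧
              ρ.re < 1 - (2022 * Real.log (Real.log D) + Real.log (9 / 200) -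
                  Real.log (10 * Real.log q + Real.log T + 107)) /
                (10 * Real.log q + Real.log T + 107) := by
  obtain ⟨D₀, H⟩ := exceptionalZero_of_assumptionA h29 hM
  refine ⟨max D₀ 400001, fun D _ hD χ hχ hA => ?_⟩
  have hD₀ : D₀ ≤ D := le_trans (le_max_left _ _) hD
  have hD4 : 400001 ≤ D := le_trans (le_max_right _ _) hD
  obtain ⟨β₁, hlo, hhi, hz, -, -, -, h72, hgap⟩ := H D hD₀ χ hχ hA
  have hD4r : (400001 : ℝ) ≤ D := by exact_mod_cast hD4
  have hlogD : 1 < Real.log D := by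
    rw [Real.lt_log_iff_exp_lt (by linarith)]
    linarith [Real.exp_one_lt_d9]
  have hLpos : 0 < Real.log D ^ 2022 := by positivity
  have h1β : 0 < 1 - β₁ := by linarith
  refine ⟨β₁, hlo, hhi, hz, hgap, fun q _ hdvd hlogq T hT ψ ρ hρ1 hρβ hρ0 hre him => ?_⟩
  -- sizes at level `q`
  have hqD : D ≤ q := Nat.le_of_dvd (Nat.pos_of_ne_zero (NeZero.ne q)) hdvd
  have hq4 : 400000 < q := lt_of_lt_of_le (by norm_num) (le_trans hD4 hqD)
  have hqr : (400001 : ℝ) ≤ q := by exact_mod_cast le_trans hD4 hqD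
  have hlogq1 : 1 < Real.log q := by
    rw [Real.lt_log_iff_exp_lt (by linarith)]
    linarith [Real.exp_one_lt_d9]
  have hlogT : 0 < Real.log T := Real.log_pos (by linarith)
  set K : ℝ := 10 * Real.log q + Real.log T + 107 with hKdef
  have hK : 0 < K := by rw [hKdef]; positivity
  -- the window at level `q`: `1 − 1/(10 log q) < β₁`
  have hwin : 1 - 1 / (10 * Real.log q) < β₁ := by
    have h1 : 25 / 18 / Real.log D ^ 2022 ≤ 1 / (10 * Real.log q) := by
      rw [div_le_div_iff₀ hLpos (by positivity)]
      nlinarith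
    linarith
  -- `β₁` is a zero of `L(s, χ lifted to level q)`
  have hzq : (DirichletCharacter.changeLevel hdvd χ).LFunction β₁ = 0 := by
    rw [DirichletCharacter.LFunction_changeLevel hdvd χ (Or.inl hχ), hz, zero_mul]
  -- Corollary 1.1 at level `q`
  have hrep := h11 q hq4 T hT (DirichletCharacter.changeLevel hdvd χ) β₁ hwin hhi hzq ψ ρ hρ1 hρβ
    hρ0 hre him
  refine ⟨hrep, lt_trans hrep ?_⟩
  -- explicit form: `repulsionBound < 1 − (log((9/200) (log D)^2022 / K))/K`
  have hX : 9 / 200 * Real.log D ^ 2022 / K < 1 / 16 / ((1 - β₁) * K) := by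
    rw [div_lt_div_iff₀ hK (by positivity)]
    -- `(9/200) L^2022 ((1-β₁) K) < (1/16) K` since `(1-β₁) L^2022 < 25/18`
    have h2 : (1 - β₁) * Real.log D ^ 2022 < 25 / 18 := by
      rwa [lt_div_iff₀ hLpos] at hgap
    nlinarith
  have hYpos : 0 < 9 / 200 * Real.log D ^ 2022 / K := by positivity
  have hlog : Real.log (9 / 200 * Real.log D ^ 2022 / K) <
      Real.log (1 / 16 / ((1 - β₁) * K)) := Real.log_lt_log hYpos hX
  have hexp : Real.log (9 / 200 * Real.log D ^ 2022 / K) =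
      2022 * Real.log (Real.log D) + Real.log (9 / 200) - Real.log K := by
    rw [Real.log_div (by positivity) hK.ne', Real.log_mul (by norm_num) (by positivity),
      Real.log_pow]
    push_cast
    ring
  unfold BGTZ2025.repulsionBound
  rw [← hexp]
  have hKq : (10 : ℝ) * Real.log q + 1 * Real.log T + 107 = K := by rw [hKdef]; ring
  rw [hKq]
  have := div_lt_div_of_pos_right hlog hK
  linarith


/-! ### The (A)-world explicit zero-density saving for the family `q ≤ Q` (appended 2026-08-26, row dhE-04)

Thorner–Zaman's Theorem 1.2, second conjunct (`thornerZaman2024_theorem12`): `N*(σ,Q) ≤ 10⁹³ ·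
min{1, (1 − β₁(Q)) log Q} · (10⁴⁶⁶Q¹⁷⁰)^{1−σ}` for `Q ≥ 3`, `σ ≥ 39/40`. Under (A), for `Q ≥ D` and
`χ` PRIMITIVE mod `D`, the exceptional zero `β₁` of `exceptionalZero_of_assumptionA` belongs to the
family's real zero set, so `β₁(Q) = ThornerZaman2024.betaOne Q ≥ β₁` and the Deuring–Heilbronn
factor is at most `(1 − β₁) log Q < (25/18)(log D)⁻²⁰²² log Q`: the count of all OTHER zeros of all
primitive `L(s,ψ)`, `q ≤ Q`, in `β > σ`, `|γ| ≤ Q` is `≤ 10⁹³ (25/18)(log D)⁻²⁰²² (log Q)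
(10⁴⁶⁶Q¹⁷⁰)^{1−σ}` — the ZD line of design dh-zd-001 (B-dh/PLAN.md §3) as a decl. -/

/-- Every real zero of the family `𝓛(s,Q)` is `≤ 2` (indeed `< 1`; `2` avoids the pole bookkeeping of
`ζ` at `s = 1`): `L(β,χ) ≠ 0` for `Re β ≥ 1`, `β ≠ 1`. [cite: ThornerZaman2024LogFree, §1 (display defining β₁(Q))] -/
theorem realZeroSet_bddAbove (Q : ℝ) : BddAbove (ThornerZaman2024.realZeroSet Q) := by
  refine ⟨2, ?_⟩
  rintro β ⟨i, -, χ, -, hz⟩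
  by_contra hlt
  push Not at hlt
  have hne : ((β : ℝ) : ℂ) ≠ 1 := by
    intro h
    have : β = 1 := by exact_mod_cast h
    linarith
  exact DirichletCharacter.LFunction_ne_zero_of_one_le_re χ (Or.inr hne)
    (by rw [Complex.ofReal_re]; linarith) hz

/-- **The (A)-world zero-density saving (row dhE-04 instantiated under (A)).** Given
Benli–Goel–Twiss–Zaman's Lemma 2.9, McCurley's Theorem 1 and Thorner–Zaman's Theorem 1.2
(`thornerZaman2024_theorem12`): there is `D₀` such that for every `D ≥ D₀`, every PRIMITIVE
`χ ≠ χ₀` mod `D` with Assumption (A), every `Q ≥ D` and every `σ ≥ 39/40`,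
`N*(σ,Q) ≤ 10⁹³ · ((25/18)(log D)⁻²⁰²² · log Q) · (10⁴⁶⁶ Q¹⁷⁰)^{1−σ}`, where
`N*(σ,Q) = ThornerZaman2024.zeroCountExcl σ Q` counts (with multiplicity) the zeros `≠ β₁(Q)` of all
primitive `L(s,ψ)`, `q ≤ Q`, with `β > σ`, `|γ| ≤ Q` (the exceptional zero `β₁` of `L(s,χ)` gives
`β₁(Q) ≥ β₁`, whence `min{1,(1 − β₁(Q)) log Q} ≤ (1 − β₁) log Q < (25/18)(log D)⁻²⁰²² log Q`).
[cite: ThornerZaman2024LogFree, Theorem 1.2] [cite: Zhang2022LandauSiegel, §2 Assumption (A)]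
[cite: BenliGoelTwissZaman2025, Lemma 2.9] -/
theorem familyZeroDensity_of_assumptionA (h29 : BGTZ2025.lemma29) (hM : McCurley1984_theorem1)
    (h12 : thornerZaman2024_theorem12) :
    ∃ D₀ : ℕ, ∀ (D : ℕ) [NeZero D], D₀ ≤ D → ∀ χ : DirichletCharacter ℂ D, χ ≠ 1 → χ.IsPrimitive →
      Skeleton.AssumptionA D χ →
      ∀ Q : ℝ, (D : ℝ) ≤ Q → ∀ σ : ℝ, 39 / 40 ≤ σ →
        (ThornerZaman2024.zeroCountExcl σ Q : ℝ) ≤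
          10 ^ 93 * (25 / 18 / Real.log D ^ 2022 * Real.log Q) * (10 ^ 466 * Q ^ 170) ^ (1 - σ) := by
  obtain ⟨D₀, H⟩ := exceptionalZero_of_assumptionA h29 hM
  refine ⟨max D₀ 3, fun D _ hD χ hχ hprim hA Q hQ σ hσ => ?_⟩
  have hD₀ : D₀ ≤ D := le_trans (le_max_left _ _) hD
  have hD3 : 3 ≤ D := le_trans (le_max_right _ _) hD
  have hD3r : (3 : ℝ) ≤ D := by exact_mod_cast hD3
  have hQ3 : 3 ≤ Q := le_trans hD3r hQ
  obtain ⟨β₁, -, hβ1, hz, -, -, -, -, hgap⟩ := H D hD₀ χ hχ hA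
  -- `β₁ ∈ realZeroSet Q`: write the modulus as `i + 1`
  obtain ⟨i, hi⟩ := Nat.exists_eq_succ_of_ne_zero (NeZero.ne D)
  subst hi
  have hmem : β₁ ∈ ThornerZaman2024.realZeroSet Q := by
    refine ⟨i, ?_, χ, hprim, hz⟩
    have : i + 1 ≤ ⌊Q⌋₊ := Nat.le_floor hQ
    omega
  have hβQ : β₁ ≤ ThornerZaman2024.betaOne Q := le_csSup (realZeroSet_bddAbove Q) hmem
  -- Theorem 1.2, second conjunct
  obtain ⟨-, hN⟩ := h12 Q hQ3 σ hσ
  have hlogQ : 0 ≤ Real.log Q := Real.log_nonneg (by linarith)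
  have hP : 0 ≤ ((10 : ℝ) ^ 466 * Q ^ 170) ^ (1 - σ) :=
    Real.rpow_nonneg (by positivity) _
  have hmin : min 1 ((1 - ThornerZaman2024.betaOne Q) * Real.log Q) ≤
      25 / 18 / Real.log ((i + 1 : ℕ) : ℝ) ^ 2022 * Real.log Q := by
    refine (min_le_right _ _).trans ?_
    have h1 : (1 - ThornerZaman2024.betaOne Q) * Real.log Q ≤ (1 - β₁) * Real.log Q :=
      mul_le_mul_of_nonneg_right (by linarith) hlogQ
    have h2 : (1 - β₁) * Real.log Q ≤ 25 / 18 / Real.log ((i + 1 : ℕ) : ℝ) ^ 2022 * Real.log Q :=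
      mul_le_mul_of_nonneg_right hgap.le hlogQ
    exact h1.trans h2
  refine hN.trans ?_
  have h10 : (0 : ℝ) ≤ 10 ^ 93 := by positivity
  exact mul_le_mul_of_nonneg_right (mul_le_mul_of_nonneg_left hmin h10) hP


/-! ### Wave 3, design dh-ci-001: Conrey–Iwaniec's subnormal-gaps route kills (A) for ODD characters
(appended 2026-08-26; `B-dh/designs/dh-ci-001.json`)

Conrey–Iwaniec 2002, Theorem 1.2 (`conreyIwaniec2002_theorem12`, a named fact of the tree): if
`≫ T (log T)^{4/5}` critical zeros of `ζ` up to height `T` have a critical neighbour within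
`(π/log γ)(1 − 1/√log γ)` for every `T ≥ 2001` (`SubnormalGapsHypothesis c`), then
`L(1,χ) ≥ c′(log q)^{−90}` for every primitive quadratic ODD `χ` mod `q > 4`. Against Assumption (A),
`L(1,χ) < (log D)^{−2022}`, this is absurd as soon as `c′(log D)^{1932} ≥ 1`. So a hypothesis about
`ζ` ALONE (exit kind (viii) of the B-dh KILL certificate: nothing in the menu `M` speaks about the
zeros of `ζ` beyond the fence rows) makes (A) eventually false — but for ODD `χ` only (imaginary
quadratic fields): the EVEN half of the hypothesis of `Zhang2022.theorem1_of_eventually_not_assumptionA`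
is not reached by this route. -/

/-- **(1.22) ⇒ eventually ¬(A) for odd characters.** Modulo Conrey–Iwaniec's Theorem 1.2: if the
subnormal-gaps hypothesis (1.22) holds with some constant `c > 0`, then there is `D₀` such that NO
primitive quadratic odd character `χ` mod `D ≥ D₀` satisfies Assumption (A) (`‖L(1,χ)‖ <
(log D)⁻²⁰²²`): indeed `‖L(1,χ)‖ ≥ c′(log D)^{−90} ≥ (log D)^{−2022}` once `log D ≥ max(1, 1/c′)`.
ODD `χ` ONLY (the source's `χ = (−q/·)`, `−q` a fundamental discriminant); the even half of
`theorem1_of_eventually_not_assumptionA`'s hypothesis is NOT reached. Inputs about `ζ` alone = exit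
kind (viii) of the B-dh KILL certificate. [cite: ConreyIwaniec2002, Theorem 1.2]
[cite: Zhang2022LandauSiegel, §2 Assumption (A)] -/
theorem eventually_not_assumptionA_odd_of_subnormalGaps (hCI : conreyIwaniec2002_theorem12)
    {c : ℝ} (hc : 0 < c) (hS : SubnormalGapsHypothesis c) :
    ∃ D₀ : ℕ, ∀ (D : ℕ) [NeZero D] (χ : DirichletCharacter ℂ D), D₀ ≤ D → χ.IsQuadratic →
      χ.IsPrimitive → χ.Odd → ¬ Skeleton.AssumptionA D χ := by
  obtain ⟨c', hc', h⟩ := hCI c hc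
  have hL := h hS
  -- `D₀` with `log D₀ ≥ m := max 1 (1/c')` and `D₀ > 4`
  set m : ℝ := max 1 (1 / c') with hm
  refine ⟨max 5 (⌈Real.exp m⌉₊), fun D _ χ hD hquad hprim hodd hA => ?_⟩
  have hD5 : 5 ≤ D := le_trans (le_max_left _ _) hD
  have hDexp : ⌈Real.exp m⌉₊ ≤ D := le_trans (le_max_right _ _) hD
  have hD4 : 4 < D := by omega
  have hDr : Real.exp m ≤ (D : ℝ) := le_trans (Nat.le_ceil _) (by exact_mod_cast hDexp)
  have hD0 : (0 : ℝ) < D := by exact_mod_cast (show 0 < D by omega)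
  have hlog : m ≤ Real.log (D : ℝ) := by
    rw [Real.le_log_iff_exp_le hD0]; exact hDr
  have hℓ1 : 1 ≤ Real.log (D : ℝ) := le_trans (le_max_left _ _) hlog
  have hℓc : 1 / c' ≤ Real.log (D : ℝ) := le_trans (le_max_right _ _) hlog
  have hℓ0 : 0 < Real.log (D : ℝ) := by linarith
  -- the two bounds on `‖L(1,χ)‖`
  have hlow := hL D hD4 χ hprim hquad hodd
  have hupp : ‖χ.LFunction 1‖ < 1 / Real.log (D : ℝ) ^ 2022 := hA
  -- `c' (log D)^{-90} = c' / (log D)^90`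
  have hrpow : Real.log (D : ℝ) ^ (-(90 : ℝ)) = 1 / Real.log (D : ℝ) ^ 90 := by
    rw [Real.rpow_neg hℓ0.le, show (90 : ℝ) = ((90 : ℕ) : ℝ) by norm_num, Real.rpow_natCast,
      one_div]
  rw [hrpow] at hlow
  -- combine: `c' / (log D)^90 < 1 / (log D)^2022`, i.e. `c' (log D)^1932 < 1`
  have hlt : c' * (1 / Real.log (D : ℝ) ^ 90) < 1 / Real.log (D : ℝ) ^ 2022 := lt_of_le_of_lt hlow hupp
  have h90 : 0 < Real.log (D : ℝ) ^ 90 := pow_pos hℓ0 _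
  have h2022 : 0 < Real.log (D : ℝ) ^ 2022 := pow_pos hℓ0 _
  have hkey : c' * Real.log (D : ℝ) ^ 1932 < 1 := by
    have h1 : c' * (1 / Real.log (D : ℝ) ^ 90) * Real.log (D : ℝ) ^ 2022 < 1 := by
      have := mul_lt_mul_of_pos_right hlt h2022
      rwa [div_mul_cancel₀ _ h2022.ne'] at this
    have h2 : c' * (1 / Real.log (D : ℝ) ^ 90) * Real.log (D : ℝ) ^ 2022 =
        c' * Real.log (D : ℝ) ^ 1932 := by
      rw [show Real.log (D : ℝ) ^ 2022 = Real.log (D : ℝ) ^ 90 * Real.log (D : ℝ) ^ 1932 by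
        rw [← pow_add], ← mul_assoc, mul_assoc c', one_div, inv_mul_cancel₀ h90.ne', mul_one]
    linarith [h1, h2]
  -- but `(log D)^1932 ≥ log D ≥ 1/c'`
  have hpow : Real.log (D : ℝ) ≤ Real.log (D : ℝ) ^ 1932 := le_self_pow₀ hℓ1 (by norm_num)
  have hge : 1 ≤ c' * Real.log (D : ℝ) ^ 1932 := by
    calc (1 : ℝ) = c' * (1 / c') := by field_simp
      _ ≤ c' * Real.log (D : ℝ) := mul_le_mul_of_nonneg_left hℓc hc'.le
      _ ≤ c' * Real.log (D : ℝ) ^ 1932 := mul_le_mul_of_nonneg_left hpow hc'.le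
  linarith

/-- **RH + Montgomery's pair correlation ⇒ eventually ¬(A) for odd characters** (design dh-ci-001
assembled): modulo the named facts `conreyIwaniec2002_theorem12` and `Gabcke.satz322b_R0` (the
latter only certifies one close pair of critical zeros below height `2001`,
`subnormalGapsHypothesis_of_pairCorrelation_gabcke`), the Riemann Hypothesis and Montgomery's pair
correlation conjecture imply that NO primitive quadratic odd `χ` mod `D ≥ D₀` satisfies Assumption
(A). ODD `χ` ONLY; the even half of `theorem1_of_eventually_not_assumptionA`'s hypothesis is NOT
reached; inputs about `ζ` alone = exit kind (viii) of the B-dh KILL certificate; RH and pair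
correlation enter as HYPOTHESES (conjectures, not rows of any menu).
[cite: ConreyIwaniec2002, Theorem 1.2] [cite: Gabcke1979, Satz 3.2.2 (b) p. 55]
[cite: Zhang2022LandauSiegel, §2 Assumption (A)] -/
theorem eventually_not_assumptionA_odd_of_RH_pairCorrelation (hCI : conreyIwaniec2002_theorem12)
    (hG : Gabcke.satz322b_R0) (hRH : RiemannHypothesis) (hpc : MontgomeryPairCorrelation) :
    ∃ D₀ : ℕ, ∀ (D : ℕ) [NeZero D] (χ : DirichletCharacter ℂ D), D₀ ≤ D → χ.IsQuadratic →
      χ.IsPrimitive → χ.Odd → ¬ Skeleton.AssumptionA D χ := by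
  obtain ⟨c, hc, hS⟩ := subnormalGapsHypothesis_of_pairCorrelation_gabcke hG hRH hpc
  exact eventually_not_assumptionA_odd_of_subnormalGaps hCI hc hS


end Literature.NumberTheory.LFunctions.Zhang2022.DH

end
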